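import Summits.HodgeConjecture.HodgeConjecture.Theorems.TropicalWeilObstructionTropicalHodgeBoundSimplexForms

/-!
# Crux `TropicalHodgeBound` (stmt-HodgeConjecture-18480), stub 4 — part R2: the discrete Stokes identity
# for closed simplicial `4`-chains on a torus

Route `TropicalWeilObstruction` of `HodgeConjecture`, registered line `birth`
(`Cruxes/TropicalHodgeBound/Lines/birth.lean`), stub `stub_rationalHodgeCoordinates`.

**Discrete Stokes** (`sum_simplexForm_eq_sum_simplexForm_sub_rep`). Let `Φ` be an alternating `4`-form
on a real vector space `V`, and let finitely many `4`-simplices `u_σ : Fin 5 → V` with integer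
coefficients `n_σ` form a CLOSED chain modulo a set of translations, in the certificate format of
`Literature.AlgebraicGeometry.Tropical.TropicalTorusCycle`: every facet slot `(σ, i)` carries a class
`f = cls σ i`, a reordering `π = perm σ i` and a shift `t = shift σ i` with
`u_σ (i.succAbove (π j)) = ρ_f j + t` for the reference simplex `ρ_f` of the class, and in every class the
signed coefficients cancel, `Σ_{(σ,i) ∈ f} n_σ (-1)^i sign π = 0`. Let `rep : V → V` be invariant under
the shifts that occur (`rep (v + shift σ i) = rep v`; for a torus `V/Λ`, `rep` = a choice of
representatives modulo `Λ` and the shifts lie in `Λ`). Then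
`Σ_σ n_σ h̃_Φ(u_σ) = Σ_σ n_σ h̃_Φ(u_σ - rep ∘ u_σ)`:
the total `Φ`-content of the chain is unchanged when every vertex `v` is replaced by `v - rep v`.

Proof (no topology): by the prism identity (`simplexForm_add_sub`) the difference is the signed sum over
all facet slots of the swept forms of the facets moving with velocities `-rep`; a facet of class `f` is
the `π`-reordered `t`-translate of `ρ_f` and its velocities are those of `ρ_f` (`rep` is shift-invariant),
so by alternation and translation invariance of the swept form (`sweptForm_comp_perm`,
`sweptForm_add_const`) its swept form is `sign π · Sw(ρ_f, -rep ∘ ρ_f)`; summing over the class gives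
`Sw(ρ_f, -rep ∘ ρ_f) · Σ_{(σ,i) ∈ f} n_σ (-1)^i sign π = 0`.

For the torus `ℝ⁸/Q·ℤ⁸` in period coordinates (`rep` = fractional part, so that `v - rep v ∈ ℤ⁸`) this
is the rationality of tropical cycle classes (file `…CycleClassRational`). No definition, no named fact,
no sorry.

References: [MikhalkinZharkov2014Eigenwave] G. Mikhalkin, I. Zharkov, Tropical eigenwave and intermediate
Jacobians, LN UMI 15 (2014), Def. 4.2, Prop. 4.3; [Zharkov2020TropicalWeil] I. Zharkov, arXiv:2002.02347,
p. 2 ("`vol(Z) ∈ ⋀ᵖΓ₁ ⊗ ⋀ᵖΓ₂`").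
-/

set_option linter.dupNamespace false

namespace Summit.HodgeConjecture.HodgeConjecture.Theorems.TropicalHodgeBound

open scoped BigOperators

section Stokes

variable {V : Type*} [AddCommGroup V] [Module ℝ V]
variable {ι F : Type*} [Fintype ι] [Fintype F] [DecidableEq F]

/-- **The swept form of a facet slot.** If the facet `u ∘ i.succAbove` of a simplex, reordered by `π`,
is the `t`-translate of a reference simplex `ρ`, and `rep` is `t`-invariant, then the swept form of the
facet moving with velocities `-rep` is `sign π` times that of `ρ`. [folklore] -/
theorem sweptForm_facet (Φ : V [⋀^Fin 4]→ₗ[ℝ] ℝ) (rep : V → V) (u : Fin 5 → V) (i : Fin 5)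
    (π : Equiv.Perm (Fin 4)) (ρ : Fin 4 → V) (t : V)
    (hfacet : ∀ j, u (i.succAbove (π j)) = ρ j + t) (hrep : ∀ v, rep (v + t) = rep v) :
    sweptForm Φ (fun j => u (i.succAbove j)) (fun j => - rep (u (i.succAbove j))) =
      (((Equiv.Perm.sign π : ℤˣ) : ℤ) : ℝ) * sweptForm Φ ρ (fun j => - rep (ρ j)) := by
  have hs2 : (((Equiv.Perm.sign π : ℤˣ) : ℤ) : ℝ) * (((Equiv.Perm.sign π : ℤˣ) : ℤ) : ℝ) = 1 := by
    rw [← Int.cast_mul, ← Units.val_mul, Int.units_mul_self]; simp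
  -- reorder by `π`
  have h1 := sweptForm_comp_perm Φ π (fun j => u (i.succAbove j)) (fun j => - rep (u (i.succAbove j)))
  have hy : ((fun j => u (i.succAbove j)) ∘ ⇑π) = fun j => ρ j + t := by
    funext j; simp only [Function.comp_apply, hfacet]
  have hz : ((fun j => - rep (u (i.succAbove j))) ∘ ⇑π) = fun j => - rep (ρ j) := by
    funext j; simp only [Function.comp_apply, hfacet, hrep]
  rw [hy, hz, sweptForm_add_const] at h1
  -- `h1 : Sw(ρ, -rep ρ) = sign π * Sw(facet)`; multiply by `sign π`
  calc sweptForm Φ (fun j => u (i.succAbove j)) (fun j => - rep (u (i.succAbove j)))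
      = ((((Equiv.Perm.sign π : ℤˣ) : ℤ) : ℝ) * (((Equiv.Perm.sign π : ℤˣ) : ℤ) : ℝ)) *
          sweptForm Φ (fun j => u (i.succAbove j)) (fun j => - rep (u (i.succAbove j))) := by
        rw [hs2, one_mul]
    _ = (((Equiv.Perm.sign π : ℤˣ) : ℤ) : ℝ) * sweptForm Φ ρ (fun j => - rep (ρ j)) := by
        rw [h1]; ring

/-- **DISCRETE STOKES** for a closed simplicial `4`-chain in certificate format (classes / reorderings /
shifts of the facet slots, per-class cancellation of the signed coefficients) and a shift-invariant
`rep`: the total `Φ`-content `Σ_σ n_σ h̃_Φ(u_σ)` is unchanged when every vertex `v` is replaced by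
`v - rep v`. [cite: MikhalkinZharkov2014Eigenwave, Prop. 4.3] -/
theorem sum_simplexForm_eq_sum_simplexForm_sub_rep (Φ : V [⋀^Fin 4]→ₗ[ℝ] ℝ) (rep : V → V)
    (u : ι → Fin 5 → V) (n : ι → ℤ) (cls : ι → Fin 5 → F) (perm : ι → Fin 5 → Equiv.Perm (Fin 4))
    (shift : ι → Fin 5 → V) (ρ : F → Fin 4 → V)
    (hfacet : ∀ σ i j, u σ (i.succAbove (perm σ i j)) = ρ (cls σ i) j + shift σ i)
    (hrep : ∀ σ i v, rep (v + shift σ i) = rep v)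
    (hbal : ∀ f, ∑ σ, ∑ i : Fin 5, (if cls σ i = f then
      (n σ : ℝ) * (-1 : ℝ) ^ (i : ℕ) * (((Equiv.Perm.sign (perm σ i) : ℤˣ) : ℤ) : ℝ) else 0) = 0) :
    ∑ σ, (n σ : ℝ) * simplexForm Φ (u σ) =
      ∑ σ, (n σ : ℝ) * simplexForm Φ (fun k => u σ k - rep (u σ k)) := by
  -- velocities `z = -rep ∘ u`
  have hz : ∀ σ, (fun k => u σ k - rep (u σ k)) = u σ + fun k => - rep (u σ k) := by
    intro σ; funext k; simp [sub_eq_add_neg]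
  -- the swept form of every facet slot
  have hslot : ∀ σ i, sweptForm Φ (fun j => u σ (i.succAbove j)) (fun j => - rep (u σ (i.succAbove j))) =
      (((Equiv.Perm.sign (perm σ i) : ℤˣ) : ℤ) : ℝ) *
        sweptForm Φ (ρ (cls σ i)) (fun j => - rep (ρ (cls σ i) j)) :=
    fun σ i => sweptForm_facet Φ rep (u σ) i (perm σ i) (ρ (cls σ i)) (shift σ i) (hfacet σ i) (hrep σ i)
  -- difference = signed sum of swept forms = 0
  rw [← sub_eq_zero, ← Finset.sum_sub_distrib]
  calc ∑ σ, ((n σ : ℝ) * simplexForm Φ (u σ) - (n σ : ℝ) * simplexForm Φ (fun k => u σ k - rep (u σ k)))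
      = ∑ σ, - ((n σ : ℝ) * ∑ i : Fin 5, (-1 : ℝ) ^ (i : ℕ) *
          sweptForm Φ (fun j => u σ (i.succAbove j)) (fun j => - rep (u σ (i.succAbove j)))) := by
        refine Finset.sum_congr rfl fun σ _ => ?_
        have h := simplexForm_add_sub Φ (u σ) (fun k => - rep (u σ k))
        rw [hz σ, ← h]
        ring
    _ = - ∑ σ, ∑ i : Fin 5, (n σ : ℝ) * (-1 : ℝ) ^ (i : ℕ) *
          (((Equiv.Perm.sign (perm σ i) : ℤˣ) : ℤ) : ℝ) *
            sweptForm Φ (ρ (cls σ i)) (fun j => - rep (ρ (cls σ i) j)) := by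
        rw [← Finset.sum_neg_distrib]
        refine Finset.sum_congr rfl fun σ _ => ?_
        rw [Finset.mul_sum]
        congr 1
        refine Finset.sum_congr rfl fun i _ => ?_
        rw [hslot σ i]; ring
    _ = - ∑ f, sweptForm Φ (ρ f) (fun j => - rep (ρ f j)) *
          ∑ σ, ∑ i : Fin 5, (if cls σ i = f then
            (n σ : ℝ) * (-1 : ℝ) ^ (i : ℕ) * (((Equiv.Perm.sign (perm σ i) : ℤˣ) : ℤ) : ℝ) else 0) := by
        congr 1
        -- regroup the slots by class
        have hreg : ∀ (σ : ι) (i : Fin 5), (n σ : ℝ) * (-1 : ℝ) ^ (i : ℕ) *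
            (((Equiv.Perm.sign (perm σ i) : ℤˣ) : ℤ) : ℝ) *
              sweptForm Φ (ρ (cls σ i)) (fun j => - rep (ρ (cls σ i) j)) =
            ∑ f, sweptForm Φ (ρ f) (fun j => - rep (ρ f j)) * (if cls σ i = f then
              (n σ : ℝ) * (-1 : ℝ) ^ (i : ℕ) * (((Equiv.Perm.sign (perm σ i) : ℤˣ) : ℤ) : ℝ) else 0) := by
          intro σ i
          rw [Finset.sum_eq_single (cls σ i)]
          · rw [if_pos rfl]; ring
          · intro f _ hf; rw [if_neg (Ne.symm hf), mul_zero]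
          · intro h; exact absurd (Finset.mem_univ _) h
        simp_rw [hreg]
        calc ∑ σ, ∑ i : Fin 5, ∑ f, sweptForm Φ (ρ f) (fun j => - rep (ρ f j)) * (if cls σ i = f then
                (n σ : ℝ) * (-1 : ℝ) ^ (i : ℕ) * (((Equiv.Perm.sign (perm σ i) : ℤˣ) : ℤ) : ℝ) else 0)
            = ∑ σ, ∑ f, ∑ i : Fin 5, sweptForm Φ (ρ f) (fun j => - rep (ρ f j)) * (if cls σ i = f then
                (n σ : ℝ) * (-1 : ℝ) ^ (i : ℕ) * (((Equiv.Perm.sign (perm σ i) : ℤˣ) : ℤ) : ℝ) else 0) :=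
              Finset.sum_congr rfl fun σ _ => Finset.sum_comm
          _ = ∑ f, ∑ σ, ∑ i : Fin 5, sweptForm Φ (ρ f) (fun j => - rep (ρ f j)) * (if cls σ i = f then
                (n σ : ℝ) * (-1 : ℝ) ^ (i : ℕ) * (((Equiv.Perm.sign (perm σ i) : ℤˣ) : ℤ) : ℝ) else 0) :=
              Finset.sum_comm
          _ = _ := by
              refine Finset.sum_congr rfl fun f _ => ?_
              rw [Finset.mul_sum]
              refine Finset.sum_congr rfl fun σ _ => ?_
              rw [Finset.mul_sum]
    _ = 0 := by
        rw [neg_eq_zero]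
        exact Finset.sum_eq_zero fun f _ => by rw [hbal f, mul_zero]

end Stokes

end Summit.HodgeConjecture.HodgeConjecture.Theorems.TropicalHodgeBound
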